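import Summits.QuantumFields.YangMills.Theorems.TwistedTraceScaling.Negative.LabelLimitGuards
import Summits.QuantumFields.YangMills.Theorems.TwistedTraceScaling.Negative.ClockRigidity
import HarnessLib

/-!
# `TwistedTraceScaling` (crux stmt-QuantumFields-20203, route `LuscherReduction`, skeleton «twolattice» rev 3):
# negative-side support — TWO-SIDED RIGIDITY OF THE CLOCK COEFFICIENT: over-corrected running clocks are false AS TYPED,
# unconditionally; mod FTL / LIM / the open stub the two-loop coefficient `b₁/b₀` is the ONLY admissible one
# (refuter crux-disprover seat, cycle 64; `--supports` only — this file does NOT refute and does NOT close the crux)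

HONEST FRAMING: `TwistedTraceScaling` is a femto-rung (R2b1) crux of a CONDITIONAL reduction route; nothing here is an infinite-volume,
mass-gap or Clay statement.  All objects are the tree's (`TraceDoor.traceRatio`, `TraceDoor.femtoSteps`, `TraceDoor.hTraceRatio`,
`InFemtoWindow`, `luscherLambda`, `invRunningCoupling`, `b0`, `b1`); every law below is SPELLED OUT (no proposition is defined under
`Summits/`).  Notation as in `Negative/ClockRigidity.lean` (cycle 3): the one-parameter family of running labels
`A_c(β, L) = β/2 − 2b₀ log L − c·log(β/(2b₀))`, clocks `Λ_c = (max A_c 0)^{−1/3}`, steps `⌈sL/Λ_c⌉`; the crux's two-loop clock is the member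
`c = b₁/b₀` (✓`clockLambda_two_loop_eq`), one-loop running is `c = 0`.  `FTL` = the femto trace law, VERBATIM the right-hand side of
✓`Tower.twistedTraceScaling_iff_femtoTraceLaw`; `LIM` = the window-free label limit, VERBATIM the right-hand side of
✓`R75.cmpTwoLoop_iff_labelLimit` (`TwoLattice.Stmt.stub_cmpTwoLoop ⟺ LIM`, the only open stub of the line).

WHAT WAS OPEN.  Cycle 3 proved ★★`not_clockTraceLaw_of_femtoTraceLaw : c < b₁/b₀ → FTL → ¬(trace law clocked by Λ_c)` (slow clocks) and
left the over-corrected side `c > b₁/b₀` undecided, for the stated reason (its docstring, (b)): there `A_c ≤ 0` eventually in the window,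
`Λ_c = 0^{−1/3} = 0`, `⌈sL/0⌉ = 0` steps (Lean junk `x/0 = 0`), so the `c`-law degenerates to a statement about `r(L, β, 0)`.

WHAT THIS FILE ADDS (tools: cycle 3's `log_beta_large_eventually`, `invRunningCoupling_le_of_window`; cycle 62's two-femto-times device of
✓`R75b.labelLimit_false_without_lambdaPos`; ✓`hTraceRatio_pos`, ✓`hTraceRatio_lt_of_small`, ✓`exists_inFemtoWindow`):

* §1 `clockLabel_eq : A_c = 1/ḡ² − (c − b₁/b₀) log(β/(2b₀))`; ★`clockLabel_nonpos_eventually`: for `c > b₁/b₀` and every depth `lam > 0`,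
  eventually in `L`, THROUGHOUT the window `W(lam, L)`, `A_c ≤ 0` (`1/ḡ² ≤ 1/lam³` while `(c − b₁/b₀) log(β/(2b₀)) → +∞`, `β > 4b₀ log L`);
  `clockSteps_eq_zero_of_nonpos : A ≤ 0 → ⌈sL/(max A 0)^{−1/3}⌉ = 0` for EVERY `s`.
* §2 ★★ `not_fastClockTraceLaw : b₁/b₀ < c → ¬(femto trace law clocked by Λ_c)` — UNCONDITIONAL (no FTL, no stub): the degenerate law is
  decidable after all, because its left side `r(L, β, 0)` does not depend on `s` while the target does — `r_𝔥(1) > 0` and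
  `r_𝔥(s₂) < r_𝔥(1)/3` for small `s₂`; two instances at tolerance `r_𝔥(1)/4`, one common depth `lam ≤ 1`, one common large lattice and one
  window point (the window is inhabited, ✓`exists_inFemtoWindow`) contradict each other.  No value of any lattice trace is used.
* §3 ★★★ `clockTraceLaw_iff_coeff_eq : FTL → ((trace law clocked by Λ_c) ↔ c = b₁/b₀)` — the clock coefficient is TWO-SIDEDLY RIGID mod FTL
  (slow side: cycle 3; fast side: §2; `c = b₁/b₀`: `clockTraceLaw_twoLoop_iff_femtoTraceLaw`); mod the crux itself this is one application
  of ✓`Tower.femtoTraceLaw_of_twistedTraceScaling` away (not restated here: no `Theses` import, as in cycle 3).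
* §4 the LIM-currency twins for the planner of a skeleton rev 4 (whose menu is stated in LIM currency): ★★`not_fastClockLabelLimit`
  (unconditional), `clockTraceLaw_of_clockLabelLimit` (window-free ⇒ windowed, any clock), `clockLabelLimit_twoLoop_iff_labelLimit`,
  ★★★`clockLabelLimit_iff_coeff_eq : LIM → (LIM_c ↔ c = b₁/b₀)` and `…_of_cmpTwoLoop : Stmt.stub_cmpTwoLoop → (LIM_c ↔ c = b₁/b₀)`.

READING FOR THE LANE.  (a) The matched number of the line is pinned on BOTH sides: any E1/RG/semiclassical mechanism whose control of the
running label carries a `log β` coefficient `c ≠ b₁/b₀` proves, if anything, a law that is refuted — by junk alone if `c > b₁/b₀` (its clock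
stops in the very window it is asked about), by FTL if `c < b₁/b₀`.  (b) For a rev-4 text: a clock written as `(max A 0)^{−1/3}` with ANY label
`A` other than the tree's `invRunningCoupling` must come with its own positivity guard `0 < A` in the hypotheses (as LIM's `0 < Λ(β, L)`
guards the tree's); without it the statement is false for the junk reason of §2 as soon as `A` can die in the window.  (c) Nothing here bears on
the truth of LIM itself (believed true: asymptotic freedom); the open content of the stub is unchanged — one quantifier swap `∃Λ0 ∀L`.
No definitions, no `sorry`.
-/

set_option autoImplicit false

noncomputable section

open MeasureTheory Filter Topology Real
open Literature.MathematicalPhysics.QuantumFieldTheory hiding SU2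
open Literature.MathematicalPhysics.QuantumLattice
open Literature.Analysis.OperatorTheory.YMMatrixModel
open scoped BigOperators

namespace Summit.QuantumFields.YangMills.Theorems.TwistedTraceScaling.Negative.R79

open Summit.QuantumFields.YangMills.Theorems.FemtoTransferGap
open Summit.QuantumFields.YangMills.Theorems.FemtoTransferGap.TraceDoor
open Summit.QuantumFields.YangMills.Theorems.FemtoTransferGap.TT
open Summit.QuantumFields.YangMills.Theorems.FemtoTransferGap.TwoLattice

/-! ## §1 The `c`-label against the two-loop label; over-corrected labels die in the window -/

/-- `A_c(β, L) = 1/ḡ²(β, L) − (c − b₁/b₀)·log(β/(2b₀))` for `β > 0` (`invRunningCoupling_eq`). [cite: LuscherMunster1984, §2] -/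
theorem clockLabel_eq {β : ℝ} (hβ : 0 < β) (L : ℕ) (c : ℝ) :
    β / 2 - 2 * b0 * Real.log L - c * Real.log (β / (2 * b0)) =
      invRunningCoupling β L - (c - b1 / b0) * Real.log (β / (2 * b0)) := by
  have hb0 : 0 < b0 := by unfold b0; positivity
  rw [BOHandover.invRunningCoupling_eq, Real.log_div hβ.ne' (by positivity), Real.log_div (by positivity) hβ.ne']
  ring

/-- ★ **Every over-corrected label is eventually non-positive throughout the two-loop window.**  For `c > b₁/b₀` and every depth
`lam > 0`: eventually in `L`, for every `β` in `W(lam, L)`, `A_c(β, L) = β/2 − 2b₀ log L − c log(β/(2b₀)) ≤ 0` — because there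
`0 < 1/ḡ² ≤ 1/lam³` (`invRunningCoupling_le_of_window`) while `(c − b₁/b₀) log(β/(2b₀)) > 1/lam³` once `L` is large
(`log_beta_large_eventually`, from `β > 4b₀ log L`). [folklore] -/
theorem clockLabel_nonpos_eventually {c : ℝ} (hc : b1 / b0 < c) {lam : ℝ} (hlam : 0 < lam) :
    ∃ L1 : ℕ, ∀ (L : ℕ) [NeZero L], L1 ≤ L → ∀ β : ℝ, InFemtoWindow lam β L →
      β / 2 - 2 * b0 * Real.log L - c * Real.log (β / (2 * b0)) ≤ 0 := by
  have hκ : 0 < c - b1 / b0 := by linarith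
  obtain ⟨L1, HL1⟩ := log_beta_large_eventually (1 / ((c - b1 / b0) * lam ^ 3)) hlam
  refine ⟨L1, fun L _ hL β hW => ?_⟩
  have hM := HL1 L hL β hW
  obtain ⟨-, hvle⟩ := invRunningCoupling_le_of_window hlam hW
  have hβ0 : 0 < β := by linarith [hW.1]
  rw [clockLabel_eq hβ0]
  have hlog : 1 / lam ^ 3 < (c - b1 / b0) * Real.log (β / (2 * b0)) := by
    have := (div_lt_iff₀ (by positivity : 0 < (c - b1 / b0) * lam ^ 3)).mp hM
    rw [div_lt_iff₀ (by positivity)]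
    nlinarith
  linarith

/-- **A dead label stops its clock**: `⌈s·L/(max A 0)^{−1/3}⌉ = 0` for `A ≤ 0` and EVERY `s` (Lean junk: `0^{−1/3} = 0`, `x/0 = 0`).
[folklore] -/
theorem clockSteps_eq_zero_of_nonpos {A : ℝ} (hA : A ≤ 0) (s : ℝ) (L : ℕ) :
    ⌈s * L / (max A 0) ^ (-(1 : ℝ) / 3)⌉₊ = 0 := by
  have h3 : (-(1 : ℝ) / 3) ≠ 0 := by norm_num
  rw [max_eq_right hA, Real.zero_rpow h3, div_zero, Nat.ceil_zero]

/-- At the two-loop coefficient the family's step count IS the crux's: `⌈sL/Λ_{b₁/b₀}⌉ = femtoSteps s β L` for `β > 0`. [folklore] -/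
theorem clockSteps_two_loop_eq {β : ℝ} (hβ : 0 < β) (s : ℝ) (L : ℕ) :
    ⌈s * L / (max (β / 2 - 2 * b0 * Real.log L - (b1 / b0) * Real.log (β / (2 * b0))) 0) ^ (-(1 : ℝ) / 3)⌉₊ = femtoSteps s β L := by
  unfold femtoSteps
  rw [clockLambda_two_loop_eq hβ]

/-! ## §2 ★★ Over-corrected clocks are false AS TYPED — unconditionally (junk `T = 0`, two femto times) -/

/-- ★★ **Every over-corrected running clock is refuted outright.**  For `c > b₁/b₀` the femto trace law clocked by
`Λ_c = (max (β/2 − 2b₀ log L − c log(β/(2b₀))) 0)^{−1/3}` (steps `⌈sL/Λ_c⌉`, window unchanged — VERBATIM the law of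
✓`not_clockTraceLaw_of_femtoTraceLaw`) is FALSE, with no hypothesis: at any admissible depth `lam ≤ 1` and every large `L` the label is dead
throughout the window (`clockLabel_nonpos_eventually`), so the law speaks about `r(L, β, 0)` for EVERY `s` (`clockSteps_eq_zero_of_nonpos`),
an `s`-independent number, whereas `r_𝔥(1) > 0` (✓`hTraceRatio_pos`) and `r_𝔥(s₂) < r_𝔥(1)/3` for small `s₂` (✓`hTraceRatio_lt_of_small`):
the instances `s = 1` and `s = s₂` at tolerance `r_𝔥(1)/4`, read at one window point (✓`exists_inFemtoWindow`), contradict each other.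
This closes the side left open in cycle 3 (`ClockRigidity`, reading (b)). [folklore] -/
theorem not_fastClockTraceLaw {c : ℝ} (hc : b1 / b0 < c) :
    ¬ (∀ s : ℝ, 0 < s → ∀ ε : ℝ, 0 < ε → ∃ lam0 : ℝ, 0 < lam0 ∧ ∀ lam : ℝ, 0 < lam → lam ≤ lam0 →
        ∃ L0 : ℕ, ∀ (L : ℕ) [NeZero L], L0 ≤ L → ∀ β : ℝ, InFemtoWindow lam β L →
          |traceRatio L β ⌈s * L / (max (β / 2 - 2 * b0 * Real.log L - c * Real.log (β / (2 * b0))) 0) ^ (-(1 : ℝ) / 3)⌉₊ -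
            hTraceRatio s| ≤ ε) := by
  intro h
  -- two femto times with separated targets: `r_𝔥(1) > 0`, `r_𝔥(s₂) < r_𝔥(1)/3`
  have hr1 : 0 < hTraceRatio 1 := hTraceRatio_pos one_pos
  obtain ⟨s₀, hs₀, hsmall⟩ := hTraceRatio_lt_of_small (c := hTraceRatio 1 / 3) (by positivity)
  obtain ⟨s₂, hs₂def⟩ : ∃ s₂ : ℝ, s₂ = min s₀ 1 := ⟨_, rfl⟩
  have hs₂ : 0 < s₂ := by rw [hs₂def]; exact lt_min hs₀ one_pos
  have hr2 : hTraceRatio s₂ < hTraceRatio 1 / 3 := hsmall s₂ hs₂ (by rw [hs₂def]; exact min_le_left _ _)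
  -- two instances of the law at tolerance `r_𝔥(1)/4`, one common depth `lam ≤ 1`
  obtain ⟨lam1, hlam1, H1⟩ := h 1 one_pos (hTraceRatio 1 / 4) (by positivity)
  obtain ⟨lam2, hlam2, H2⟩ := h s₂ hs₂ (hTraceRatio 1 / 4) (by positivity)
  obtain ⟨lam, hlamdef⟩ : ∃ lam : ℝ, lam = min (min lam1 lam2) 1 := ⟨_, rfl⟩
  have hlam : 0 < lam := by rw [hlamdef]; exact lt_min (lt_min hlam1 hlam2) one_pos
  have hle1 : lam ≤ lam1 := by rw [hlamdef]; exact (min_le_left _ _).trans (min_le_left _ _)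
  have hle2 : lam ≤ lam2 := by rw [hlamdef]; exact (min_le_left _ _).trans (min_le_right _ _)
  have hle : lam ≤ 1 := by rw [hlamdef]; exact min_le_right _ _
  obtain ⟨L01, G1⟩ := H1 lam hlam hle1
  obtain ⟨L02, G2⟩ := H2 lam hlam hle2
  -- the over-corrected label is dead at depth `lam` from some size on
  obtain ⟨L1, HL1⟩ := clockLabel_nonpos_eventually hc hlam
  -- one common lattice, one window point
  obtain ⟨L, hLdef⟩ : ∃ L : ℕ, L = max (max L01 L02) (max L1 1) := ⟨_, rfl⟩
  have hLpos : 0 < L := by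
    rw [hLdef]; exact lt_of_lt_of_le one_pos ((le_max_right L1 1).trans (le_max_right _ _))
  haveI : NeZero L := ⟨hLpos.ne'⟩
  have hL01 : L01 ≤ L := by rw [hLdef]; exact (le_max_left L01 L02).trans (le_max_left _ _)
  have hL02 : L02 ≤ L := by rw [hLdef]; exact (le_max_right L01 L02).trans (le_max_left _ _)
  have hL1 : L1 ≤ L := by rw [hLdef]; exact (le_max_left L1 1).trans (le_max_right _ _)
  obtain ⟨β, hW, -⟩ := exists_inFemtoWindow L hlam hle
  have hA := HL1 L hL1 β hW
  have h1 := G1 L hL01 β hW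
  have h2 := G2 L hL02 β hW
  rw [clockSteps_eq_zero_of_nonpos hA] at h1 h2
  have e1 := (abs_le.mp h1).1
  have e2 := (abs_le.mp h2).2
  linarith

/-! ## §3 ★★★ Two-sided rigidity of the clock coefficient mod FTL (hence mod the crux, `TwistedTraceScaling → FTL`) -/

/-- **At `c = b₁/b₀` the clock law IS the femto trace law** (`⌈sL/Λ_{b₁/b₀}⌉ = femtoSteps s β L` at every window point, `β ≥ 1 > 0`).
[folklore] -/
theorem clockTraceLaw_twoLoop_iff_femtoTraceLaw :
    (∀ s : ℝ, 0 < s → ∀ ε : ℝ, 0 < ε → ∃ lam0 : ℝ, 0 < lam0 ∧ ∀ lam : ℝ, 0 < lam → lam ≤ lam0 →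
        ∃ L0 : ℕ, ∀ (L : ℕ) [NeZero L], L0 ≤ L → ∀ β : ℝ, InFemtoWindow lam β L →
          |traceRatio L β ⌈s * L / (max (β / 2 - 2 * b0 * Real.log L - (b1 / b0) * Real.log (β / (2 * b0))) 0) ^ (-(1 : ℝ) / 3)⌉₊ -
            hTraceRatio s| ≤ ε) ↔
    (∀ s : ℝ, 0 < s → ∀ ε : ℝ, 0 < ε → ∃ lam0 : ℝ, 0 < lam0 ∧ ∀ lam : ℝ, 0 < lam → lam ≤ lam0 →
        ∃ L0 : ℕ, ∀ (L : ℕ) [NeZero L], L0 ≤ L → ∀ β : ℝ, InFemtoWindow lam β L →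
          |traceRatio L β (femtoSteps s β L) - hTraceRatio s| ≤ ε) := by
  refine forall₄_congr fun s _ ε _ => exists_congr fun lam0 => and_congr_right fun _ =>
    forall₃_congr fun lam _ _ => exists_congr fun L0 => forall₄_congr fun L _ _ β => forall_congr' fun hW => ?_
  rw [clockSteps_two_loop_eq (by linarith [hW.1] : (0 : ℝ) < β)]

/-- ★★★ **The clock coefficient is two-sidedly rigid mod FTL**: given the femto trace law, the law clocked by `Λ_c` holds iff
`c = b₁/b₀` (slow side `c < b₁/b₀`: ✓`not_clockTraceLaw_of_femtoTraceLaw`, cycle 3; fast side `c > b₁/b₀`: `not_fastClockTraceLaw`, no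
hypothesis; `c = b₁/b₀`: `clockTraceLaw_twoLoop_iff_femtoTraceLaw`). [folklore] -/
theorem clockTraceLaw_iff_coeff_eq
    (hFTL : ∀ s : ℝ, 0 < s → ∀ ε : ℝ, 0 < ε → ∃ lam0 : ℝ, 0 < lam0 ∧ ∀ lam : ℝ, 0 < lam → lam ≤ lam0 →
      ∃ L0 : ℕ, ∀ (L : ℕ) [NeZero L], L0 ≤ L → ∀ β : ℝ, InFemtoWindow lam β L →
        |traceRatio L β (femtoSteps s β L) - hTraceRatio s| ≤ ε) (c : ℝ) :
    (∀ s : ℝ, 0 < s → ∀ ε : ℝ, 0 < ε → ∃ lam0 : ℝ, 0 < lam0 ∧ ∀ lam : ℝ, 0 < lam → lam ≤ lam0 →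
        ∃ L0 : ℕ, ∀ (L : ℕ) [NeZero L], L0 ≤ L → ∀ β : ℝ, InFemtoWindow lam β L →
          |traceRatio L β ⌈s * L / (max (β / 2 - 2 * b0 * Real.log L - c * Real.log (β / (2 * b0))) 0) ^ (-(1 : ℝ) / 3)⌉₊ -
            hTraceRatio s| ≤ ε) ↔ c = b1 / b0 := by
  constructor
  · intro h
    by_contra hne
    rcases lt_or_gt_of_ne hne with hlt | hgt
    · exact not_clockTraceLaw_of_femtoTraceLaw hlt hFTL h
    · exact not_fastClockTraceLaw hgt h
  · rintro rfl
    exact clockTraceLaw_twoLoop_iff_femtoTraceLaw.2 hFTL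

/-! ## §4 The LIM-currency twins (window-free label limit; `Stmt.stub_cmpTwoLoop ⟺ LIM`, ✓`R75.cmpTwoLoop_iff_labelLimit`) -/

/-- ★★ **Over-corrected clocks are refuted outright in LIM currency too.**  For `c > b₁/b₀` the window-free label limit clocked by `Λ_c`
(LIM's text VERBATIM — guards `1 ≤ β`, `0 < Λ(β, L) ≤ Λ0` on the tree's clock — with the step count `⌈sL/Λ_c⌉`) is FALSE with no
hypothesis: the depth `lam = min(Λ0₁, Λ0₂, 1)`, a large lattice and the window point `Λ(β, L) = lam` of ✓`exists_inFemtoWindow` satisfy all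
three guards while `A_c ≤ 0` there (junk `T = 0`; two femto times as in `not_fastClockTraceLaw`). [folklore] -/
theorem not_fastClockLabelLimit {c : ℝ} (hc : b1 / b0 < c) :
    ¬ (∀ s : ℝ, 0 < s → ∀ ε : ℝ, 0 < ε → ∃ Λ0 : ℝ, 0 < Λ0 ∧
        ∀ (L : ℕ) [NeZero L], ∀ β : ℝ, 1 ≤ β → 0 < luscherLambda β L → luscherLambda β L ≤ Λ0 →
          |traceRatio L β ⌈s * L / (max (β / 2 - 2 * b0 * Real.log L - c * Real.log (β / (2 * b0))) 0) ^ (-(1 : ℝ) / 3)⌉₊ -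
            hTraceRatio s| ≤ ε) := by
  intro h
  have hr1 : 0 < hTraceRatio 1 := hTraceRatio_pos one_pos
  obtain ⟨s₀, hs₀, hsmall⟩ := hTraceRatio_lt_of_small (c := hTraceRatio 1 / 3) (by positivity)
  obtain ⟨s₂, hs₂def⟩ : ∃ s₂ : ℝ, s₂ = min s₀ 1 := ⟨_, rfl⟩
  have hs₂ : 0 < s₂ := by rw [hs₂def]; exact lt_min hs₀ one_pos
  have hr2 : hTraceRatio s₂ < hTraceRatio 1 / 3 := hsmall s₂ hs₂ (by rw [hs₂def]; exact min_le_left _ _)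
  obtain ⟨Λ1, hΛ1, H1⟩ := h 1 one_pos (hTraceRatio 1 / 4) (by positivity)
  obtain ⟨Λ2, hΛ2, H2⟩ := h s₂ hs₂ (hTraceRatio 1 / 4) (by positivity)
  -- depth `lam = min(Λ0₁, Λ0₂, 1)`; the window point of `exists_inFemtoWindow` has `Λ(β, L) = lam`
  obtain ⟨lam, hlamdef⟩ : ∃ lam : ℝ, lam = min (min Λ1 Λ2) 1 := ⟨_, rfl⟩
  have hlam : 0 < lam := by rw [hlamdef]; exact lt_min (lt_min hΛ1 hΛ2) one_pos
  have hle1 : lam ≤ Λ1 := by rw [hlamdef]; exact (min_le_left _ _).trans (min_le_left _ _)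
  have hle2 : lam ≤ Λ2 := by rw [hlamdef]; exact (min_le_left _ _).trans (min_le_right _ _)
  have hle : lam ≤ 1 := by rw [hlamdef]; exact min_le_right _ _
  obtain ⟨L1, HL1⟩ := clockLabel_nonpos_eventually hc hlam
  obtain ⟨L, hLdef⟩ : ∃ L : ℕ, L = max L1 1 := ⟨_, rfl⟩
  have hLpos : 0 < L := by rw [hLdef]; exact lt_of_lt_of_le one_pos (le_max_right _ _)
  haveI : NeZero L := ⟨hLpos.ne'⟩
  have hL1 : L1 ≤ L := by rw [hLdef]; exact le_max_left _ _
  obtain ⟨β, hW, hΛ⟩ := exists_inFemtoWindow L hlam hle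
  have hΛpos : 0 < luscherLambda β L := by rw [hΛ]; exact hlam
  have hA := HL1 L hL1 β hW
  have h1 := H1 L β hW.1 hΛpos (by rw [hΛ]; exact hle1)
  have h2 := H2 L β hW.1 hΛpos (by rw [hΛ]; exact hle2)
  rw [clockSteps_eq_zero_of_nonpos hA] at h1 h2
  have e1 := (abs_le.mp h1).1
  have e2 := (abs_le.mp h2).2
  linarith

/-- **Window-free ⇒ windowed, for every clock** (`lam0 := Λ0/2`, `L0 := 0`; in `W(lam, L)`: `1 ≤ β`, `0 < Λ ≤ 2·lam ≤ Λ0`) — R75's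
`femtoTraceLaw_of_labelLimit` with the step count untouched. [folklore] -/
theorem clockTraceLaw_of_clockLabelLimit (c : ℝ)
    (h : ∀ s : ℝ, 0 < s → ∀ ε : ℝ, 0 < ε → ∃ Λ0 : ℝ, 0 < Λ0 ∧
      ∀ (L : ℕ) [NeZero L], ∀ β : ℝ, 1 ≤ β → 0 < luscherLambda β L → luscherLambda β L ≤ Λ0 →
        |traceRatio L β ⌈s * L / (max (β / 2 - 2 * b0 * Real.log L - c * Real.log (β / (2 * b0))) 0) ^ (-(1 : ℝ) / 3)⌉₊ -
          hTraceRatio s| ≤ ε) :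
    ∀ s : ℝ, 0 < s → ∀ ε : ℝ, 0 < ε → ∃ lam0 : ℝ, 0 < lam0 ∧ ∀ lam : ℝ, 0 < lam → lam ≤ lam0 →
      ∃ L0 : ℕ, ∀ (L : ℕ) [NeZero L], L0 ≤ L → ∀ β : ℝ, InFemtoWindow lam β L →
        |traceRatio L β ⌈s * L / (max (β / 2 - 2 * b0 * Real.log L - c * Real.log (β / (2 * b0))) 0) ^ (-(1 : ℝ) / 3)⌉₊ -
          hTraceRatio s| ≤ ε := by
  intro s hs ε hε
  obtain ⟨Λ0, hΛ0, H⟩ := h s hs ε hε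
  refine ⟨Λ0 / 2, by positivity, fun lam hlam hle => ⟨0, fun L _ _ β hW => ?_⟩⟩
  exact H L β hW.1 (luscherLambda_pos_of_window hlam hW) (by linarith [hW.2.2])

/-- **At `c = b₁/b₀` the clocked label limit IS LIM** (`β ≥ 1 > 0` under the guard). [folklore] -/
theorem clockLabelLimit_twoLoop_iff_labelLimit :
    (∀ s : ℝ, 0 < s → ∀ ε : ℝ, 0 < ε → ∃ Λ0 : ℝ, 0 < Λ0 ∧
        ∀ (L : ℕ) [NeZero L], ∀ β : ℝ, 1 ≤ β → 0 < luscherLambda β L → luscherLambda β L ≤ Λ0 →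
          |traceRatio L β ⌈s * L / (max (β / 2 - 2 * b0 * Real.log L - (b1 / b0) * Real.log (β / (2 * b0))) 0) ^ (-(1 : ℝ) / 3)⌉₊ -
            hTraceRatio s| ≤ ε) ↔
    (∀ s : ℝ, 0 < s → ∀ ε : ℝ, 0 < ε → ∃ Λ0 : ℝ, 0 < Λ0 ∧
        ∀ (L : ℕ) [NeZero L], ∀ β : ℝ, 1 ≤ β → 0 < luscherLambda β L → luscherLambda β L ≤ Λ0 →
          |traceRatio L β (femtoSteps s β L) - hTraceRatio s| ≤ ε) := by
  refine forall₄_congr fun s _ ε _ => exists_congr fun Λ0 => and_congr_right fun _ =>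
    forall₃_congr fun L _ β => forall_congr' fun hβ1 => ?_
  rw [clockSteps_two_loop_eq (by linarith : (0 : ℝ) < β)]

/-- ★★★ **The clock coefficient is two-sidedly rigid mod LIM**: given the window-free label limit (⟺ the open stub), the label limit clocked
by `Λ_c` holds iff `c = b₁/b₀` (slow side via `clockTraceLaw_of_clockLabelLimit`, ✓`R75.femtoTraceLaw_of_labelLimit` and cycle 3's
✓`not_clockTraceLaw_of_femtoTraceLaw`; fast side `not_fastClockLabelLimit`, no hypothesis). [folklore] -/
theorem clockLabelLimit_iff_coeff_eq
    (hLIM : ∀ s : ℝ, 0 < s → ∀ ε : ℝ, 0 < ε → ∃ Λ0 : ℝ, 0 < Λ0 ∧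
      ∀ (L : ℕ) [NeZero L], ∀ β : ℝ, 1 ≤ β → 0 < luscherLambda β L → luscherLambda β L ≤ Λ0 →
        |traceRatio L β (femtoSteps s β L) - hTraceRatio s| ≤ ε) (c : ℝ) :
    (∀ s : ℝ, 0 < s → ∀ ε : ℝ, 0 < ε → ∃ Λ0 : ℝ, 0 < Λ0 ∧
        ∀ (L : ℕ) [NeZero L], ∀ β : ℝ, 1 ≤ β → 0 < luscherLambda β L → luscherLambda β L ≤ Λ0 →
          |traceRatio L β ⌈s * L / (max (β / 2 - 2 * b0 * Real.log L - c * Real.log (β / (2 * b0))) 0) ^ (-(1 : ℝ) / 3)⌉₊ -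
            hTraceRatio s| ≤ ε) ↔ c = b1 / b0 := by
  constructor
  · intro h
    by_contra hne
    rcases lt_or_gt_of_ne hne with hlt | hgt
    · exact not_clockTraceLaw_of_femtoTraceLaw hlt (R75.femtoTraceLaw_of_labelLimit hLIM) (clockTraceLaw_of_clockLabelLimit c h)
    · exact not_fastClockLabelLimit hgt h
  · rintro rfl
    exact clockLabelLimit_twoLoop_iff_labelLimit.2 hLIM

/-- ★★★ **The same mod the open stub** `TwoLattice.Stmt.stub_cmpTwoLoop` (⟺ LIM, ✓`R75.cmpTwoLoop_iff_labelLimit`; the stub is a HYPOTHESIS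
here, nothing positive about it is asserted). [folklore] -/
theorem clockLabelLimit_iff_coeff_eq_of_cmpTwoLoop (hstub : Stmt.stub_cmpTwoLoop) (c : ℝ) :
    (∀ s : ℝ, 0 < s → ∀ ε : ℝ, 0 < ε → ∃ Λ0 : ℝ, 0 < Λ0 ∧
        ∀ (L : ℕ) [NeZero L], ∀ β : ℝ, 1 ≤ β → 0 < luscherLambda β L → luscherLambda β L ≤ Λ0 →
          |traceRatio L β ⌈s * L / (max (β / 2 - 2 * b0 * Real.log L - c * Real.log (β / (2 * b0))) 0) ^ (-(1 : ℝ) / 3)⌉₊ -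
            hTraceRatio s| ≤ ε) ↔ c = b1 / b0 :=
  clockLabelLimit_iff_coeff_eq (R75.cmpTwoLoop_iff_labelLimit.1 hstub) c

end Summit.QuantumFields.YangMills.Theorems.TwistedTraceScaling.Negative.R79

end
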